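import Summits.BirchSwinnertonDyer.Rank1Residual.Additive.X4ThreeKuriharaCertKernelIntegral
import Literature.NumberTheory.EllipticCurves.Wuthrich2014.ThreeAdicImageSupersingularProofs
import HarnessLib

/-!
# N11 LOWER@3 Kurihara-certificate record SHAPES at LARGE LEVEL (`N > 130000`): the Manin input as a
# per-pair binder `3 ∤ c_D` instead of Agashe–Ribet–Stein Thm. 2.6 (cell `b2b-bsdres`, team n1011,
# seat p03, OWNERS row T-a2-REC; kernel tool of the per-pair records, sibling of
# `Additive/X4ThreeKuriharaCertKernel{,Integral}.lean`)

HONEST FRAMING (cell `b2b-bsdres`, run/shared/lean/b2b/bsd-rank1-residual/, verbatim in every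
file): the goal of the cell is to DELETE the COMBINATION-SHAPED residual classes of the
Birch–Swinnerton-Dyer formula for ALL analytic-rank `≤ 1` elliptic curves over `ℚ` — "full BSD
formula for every rank `≤ 1` curve in class `C`" assembled STRICTLY from published theorems — so
that the rank-`≤ 1` remainder becomes exactly the CONSTRUCTION-SHAPED classes, which are TYPED
(missing-input `Prop`s), NOT attempted. This is not "finishing BSD". Team n1011 (N10/N11, the X4 ∧
`p = 3` additive block) is a RESEARCH ROUTE; no claim beyond the stated classes; the label X4 and the
mark of RESIDUAL-MAP §I N11 (LOWER@3) are UNCHANGED; nothing is booked (records are EVIDENCE-grade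
CANDIDATES for the director). An ANNOUNCED preprint enters ONLY as an explicitly labelled OPEN
hypothesis: every shape below is CONDITIONAL on C.-H. Kim (app. R. Pollack), arXiv:2505.09121v1 (2025,
PREPRINT) Thm. 1.1, binder `hK25s`, FLAG `Kim2025-preprint`. Theorems only (no definition, no named
fact minted).

## What this file proves

The three record shapes of `X4ThreeKuriharaCertKernelIntegral.lean` (unit row; Tamagawa-defect row
LOWER half; Tamagawa-defect row `BSD(E,3)` on the covered locus) take the Manin input of the optimal
datum `D` through the PUBLISHED fact `cremona_abs_maninConstant_eq_one_of_level_le`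
(Agashe–Ribet–Stein 2006 Thm. 2.6: `|c_D| = 1` for optimal curves of conductor `N ≤ 130000`), i.e.
they carry the binders `(h26) (hN : N ≤ 130000)`.  The N11 LOWER@3 rows of the ROUTE-2 niche
(`cells/n1011/route2/g18/R2-niche-p3-W4-g18.tsv`, 39 rows, `N = 19215 … 499023`) mostly sit ABOVE that
bound, where no printed Manin-constant theorem applies at `p = 3` (the curve is ADDITIVE at `3`, so
`9 ∣ N` and the prime-wise results of Mazur / Abbes–Ullmo / Česnavičius, all needing `3 ∤ N` or
`9 ∤ N`, are silent).  The ONLY use of `(h26, hN)` in the sibling proofs is the one line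
`¬ (3 : ℤ) ∣ D.maninConstant` feeding `X4.periodTransfer_of_optimal`; this file states the same three
shapes with that line as an explicit PER-PAIR binder `hc3 : ¬ (3 : ℤ) ∣ D.maninConstant` (EVIDENCE on a
record: Cremona's `ecdata` table `opt_man` lists the optimal curve and its Manin constant `c = 1` for
every class of conductor `≤ 500000` — a database entry, NOT a printed theorem, flagged as such in every
record that uses it), everything else unchanged:

* `X4RankZero.bsdp_three_of_intModel_of_maninUnit_of_towerSurj_of_kuriharaUnitAt` — unit row
  (`3 ∤ ∏ c_ℓ`): `BSDp W 3 ∧ MissingPPartAt W 3` from ONE unit Kurihara number at a cyclic `n ∈ 𝒩₁`;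
* `X4RankZero.missingLowerBoundAt_three_of_maninUnit_of_towerSurj_of_kuriharaIndexLeAt` — defect row,
  LOWER half from a level-`k` certificate, `k ≤ ord₃ ∏ c_ℓ + 1`;
* `X4RankZero.bsdp_three_of_maninUnit_of_towerSurj_of_kuriharaIndexLeAt_of_cov` — defect row,
  `BSD(E,3)` with the covered-locus UPPER half of the chain of record (Wuthrich's Lemma 20 fed by the
  tree theorem `…lemma20_surjective_threeAdic_of_semistable_holds`, so no `hL20` binder).

For `N ≤ 130000` the sibling shapes are recovered by feeding `hc3 := not_dvd_maninConstant_of_level_le h26 W D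
hopt hN Nat.prime_three` (the new binder is WEAKER than the old pair; the specialisation is the sibling's
statement verbatim, so it is not restated here — gate `dedup.landed`).
No Kato / Delbourgo fact is used on unit rows.  What is NOT changed: class X4 stays
CONSTRUCTION-SHAPED; N11's mark is unchanged; every record is CONDITIONAL on the preprint and carries
its per-pair EVIDENCE binders; nothing is booked.

References: C.-H. Kim (app. R. Pollack), arXiv:2505.09121v1 (2025, PREPRINT) Thm. 1.1, Cor. 1.7, App. §8.1
[Kim2025RefinedTNC]; C.-H. Kim, AJM 148 (2026) §1.2.2, §1.5.1, Thm. 1.10 [Kim2022StructureSelmer];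
Agashe–Ribet–Stein 2006 Thm. 2.6 and §2 (Manin constant of an optimal quotient) [AgasheRibetStein2006];
J. E. Cremona, *Algorithms for Modular Elliptic Curves*, 2nd ed. (1997), §2.9–2.11 and the `ecdata` tables
(`opt_man`) [CremonaAlgorithms1997]; Kato 2004 Thm. 14.5 (3) [Kato2004Asterisque]; C. Wuthrich, Doc. Math.
19 (2014) Lemma 20 [Wuthrich2014]; Miller 2011 Def. 1.1 [Miller2011LMS]; cell files cells/n1011/OWNERS.md
(T-a2-REC), `b2b-bsdres-n1011-p03/RECORDS-STATUS-gen5.md`.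
-/

noncomputable section

open scoped Classical MatrixGroups ModularForm

open CongruenceSubgroup WeierstrassCurve Literature.NumberTheory.EllipticCurves
  Literature.NumberTheory.EllipticCurves.ModularForms
  Literature.NumberTheory.EllipticCurves.Rank1Residual
  Literature.NumberTheory.EllipticCurves.Rank1Residual.Typed
  Literature.NumberTheory.EllipticCurves.AgasheRibetStein2006
  Summit.BirchSwinnertonDyer.BirchSwinnertonDyer.Rank1Residual.IntModel
  Summit.BirchSwinnertonDyer.Rank1Residual.GaloisImage

namespace Summit.BirchSwinnertonDyer.Rank1Residual.Additive

open Summit.BirchSwinnertonDyer.Rank1Residual.X4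

variable (W : WeierstrassCurve ℚ) [W.IsElliptic] [W.IsGloballyMinimal]

/-! ### §1 Unit row -/

/-- **T-a2-REC unit-row shape at LARGE LEVEL (Manin binder per pair).** Globally minimal elliptic `W/ℚ`,
integer model `E₀` with `3 ∣ Δ(E₀)`, `3 ∣ c₄(E₀)` (ADDITIVE at `3`); the `3`-adic tower onto (class X4);
`r_an = 0`; `3 ∤ ∏_ℓ c_ℓ`; an OPTIMAL datum `D` at ANY level `N` (`Λ_E = c_D Λ_{D.f}`) whose Manin
constant is prime to `3` (`hc3`, the per-pair EVIDENCE binder replacing Agashe–Ribet–Stein Thm. 2.6 +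
`N ≤ 130000`; so `Ω(W) = u·Ω⁺_{D.f}` with `u` a `3`-adic unit, `X4.periodTransfer_of_optimal`); the
`Ω⁺_f`-integrality is a THEOREM on tower rows (`forall_padicValRat_ratPlusSymbol_nonneg_of_towerSurj`);
ONE unit Kurihara number of `D.f` at a cyclic level `n ∈ 𝒩₁(E,3)` ⟹ `BSD(E,3) ∧ MissingPPartAt W 3`,
CONDITIONAL on the announced [K25] Thm. 1.1 PRIMARY record `hK25s`, GZK, modularity — whatever
`ord₃ #Ш_an` is; no Kato / Delbourgo fact used. FLAG `Kim2025-preprint`. Per pair; nothing booked.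
[claim: Kim2025RefinedTNC, status: under-review]
[cite: Kim2025RefinedTNC, Thm. 1.1 ("BSD"), Cor. 1.7, App. §8.1.1 (ANNOUNCED preprint — the reason, not a source of truth)]
[cite: AgasheRibetStein2006, §2 (the Manin constant of the optimal quotient; Thm. 2.6 is NOT used here)]
[cite: SilvermanAEC2009, VII.5 Prop. 5.1 (c)] [cite: Miller2011LMS, §1 and Def. 1.1] -/
theorem X4RankZero.bsdp_three_of_intModel_of_maninUnit_of_towerSurj_of_kuriharaUnitAt
    (hK25s : Kim2025.thm11_kimShaLength_of_integralPeriod_OPEN)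
    (hGZK : rank_eq_analyticRank_of_analyticRank_le_one) (hmod : hasEntireLFunction_rat)
    {E₀ : WeierstrassCurve ℤ} (hI : integralModelInt W = E₀)
    (hΔ : (3 : ℤ) ∣ E₀.Δ) (hc₄ : (3 : ℤ) ∣ E₀.c₄)
    (htower : ∀ n : ℕ, W.HasSurjectiveModNGaloisRep (3 ^ n : ℕ))
    (hr : W.analyticRank = 0) (htam : ¬ 3 ∣ W.tamagawaProduct)
    {N : ℕ} [NeZero N] (D : ModularParametrizationData W N)
    (hopt : ∀ z ∈ D.L.lattice, ∃ w ∈ periodLattice D.f, z = D.c * w)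
    (hc3 : ¬ (3 : ℤ) ∣ D.maninConstant)
    (hK : haveI : Fact (Nat.Prime 3) := ⟨Nat.prime_three⟩; X4.KuriharaUnitAt W 3 D.f) :
    haveI : Fact (Nat.Prime 3) := ⟨Nat.prime_three⟩
    BSDp W 3 ∧ MissingPPartAt W 3 := by
  haveI : Fact (Nat.Prime 3) := ⟨Nat.prime_three⟩
  have hsurj : W.HasSurjectiveModNGaloisRep 3 := by simpa using htower 1
  have hX : ClassX4 W 3 :=
    ⟨by norm_num, addv_of_intModel hI 3 (by exact_mod_cast hΔ) (by exact_mod_cast hc₄),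
      hasIrreducibleModPGaloisRep_of_hasSurjectiveModNGaloisRep W 3 hsurj⟩
  have hper : ∃ u : ℚ, ‖(u : ℚ_[3])‖ = 1 ∧ W.realPeriodRat = u * plusPeriod D.f :=
    periodTransfer_of_optimal 3 D hopt hc3
  have hB : BSDp W 3 :=
    X4RankZero.bsdp_of_integralPeriod_OPEN_of_kuriharaUnitAt W 3 (cor17_unit_OPEN_of_thm11_OPEN hK25s)
      hGZK hmod hr hX htower D.isNewformOf hper
      (forall_padicValRat_ratPlusSymbol_nonneg_of_towerSurj (by norm_num) D.isNewformOf htower) htam hK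
  haveI : Finite W.sha := (hGZK W (by rw [hr]; exact zero_le_one)).2
  exact ⟨hB, missingPPartAt_of_bsdp W 3 hB⟩

/-! ### §2 Tamagawa-defect row -/

/-- **T-a2-REC Tamagawa-defect shape at LARGE LEVEL, LOWER half** (tower row, `r_an = 0`, optimal datum
`D` at any level with `3 ∤ c_D` — the per-pair Manin binder `hc3` —, certificate
`KuriharaIndexLeAt W 3 D.f (ord₃ ∏ c_ℓ)`: cyclic `n ∈ 𝒩_k`, `k ≤ ord₃ ∏ c_ℓ + 1`, `δ̃_n^{(k)} ≢ 0 (mod 3^k)`)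
⟹ `Typed.MissingLowerBoundAt W 3`, CONDITIONAL on `hK25s` (additive-p4's LOWER ⟺ `∂^{(∞)} ≤ ord₃ ∏c`,
p03's `kimTamagawaDefectLeAt_iff_kuriharaIndexLeAt`); integrality a THEOREM on tower rows. FLAG
`Kim2025-preprint`. Per pair; nothing booked. [claim: Kim2025RefinedTNC, status: under-review]
[cite: Kim2025RefinedTNC, Thm. 1.1 ("BSD"), App. §8.1.2 (ANNOUNCED preprint — the reason, not a source of truth)]
[cite: Kim2022StructureSelmer, Conj. 1.10 and §1.5.1 (PDF pp. 7–8)]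
[cite: AgasheRibetStein2006, §2 (the Manin constant of the optimal quotient)] -/
theorem X4RankZero.missingLowerBoundAt_three_of_maninUnit_of_towerSurj_of_kuriharaIndexLeAt
    (hK25s : Kim2025.thm11_kimShaLength_of_integralPeriod_OPEN)
    (hGZK : rank_eq_analyticRank_of_analyticRank_le_one) (hmod : hasEntireLFunction_rat)
    (htower : ∀ n : ℕ, W.HasSurjectiveModNGaloisRep (3 ^ n : ℕ)) (hr : W.analyticRank = 0)
    {N : ℕ} [NeZero N] (D : ModularParametrizationData W N)
    (hopt : ∀ z ∈ D.L.lattice, ∃ w ∈ periodLattice D.f, z = D.c * w)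
    (hc3 : ¬ (3 : ℤ) ∣ D.maninConstant)
    (hK : haveI : Fact (Nat.Prime 3) := ⟨Nat.prime_three⟩;
      KuriharaIndexLeAt W 3 D.f (padicValNat 3 W.tamagawaProduct)) :
    haveI : Fact (Nat.Prime 3) := ⟨Nat.prime_three⟩
    MissingLowerBoundAt W 3 := by
  haveI : Fact (Nat.Prime 3) := ⟨Nat.prime_three⟩
  have hper : ∃ u : ℚ, ‖(u : ℚ_[3])‖ = 1 ∧ W.realPeriodRat = u * plusPeriod D.f :=
    periodTransfer_of_optimal 3 D hopt hc3
  exact (missingLowerBoundAt_iff_kimTamagawaDefectLeAt_of_kim2025_OPEN W 3 hK25s hGZK hmod le_rfl hr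
    htower D hper
    (forall_padicValRat_ratPlusSymbol_nonneg_of_towerSurj (by norm_num) D.isNewformOf htower)).mpr
    ((kimTamagawaDefectLeAt_iff_kuriharaIndexLeAt W 3 D.f).mpr hK)

/-- **T-a2-REC Tamagawa-defect shape at LARGE LEVEL, `BSD(E,3)`**: the LOWER half above plus the UPPER
half of the chain of record on the COVERED LOCUS `hcov` (`X4RankZero.missingUpperBoundAt_of_facts`:
`ord₃ j < 0` — Delbourgo `hDel`, `hmodD`, Kato half-eigen `hKatoχ`, with Wuthrich's Lemma 20 supplied by
the tree THEOREM `Wuthrich2014.lemma20_surjective_threeAdic_of_semistable_holds` (no `hL20` binder) — ∨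
tower ∧ `ord₃ ∏ c_ℓ = ord₃ c₃` ∧ a Manin datum prime to `3` — sharp Kato A161 `hKatoS`, FLAG
`Kato-14.5(3)-14.16(2)-additive-potgood-reading-sharp`); `Addv` read off the integer model; optimal
datum at any level with the per-pair Manin binder `hc3`. CONDITIONAL on `hK25s` (FLAG `Kim2025-preprint`).
Per pair; nothing booked. [claim: Kim2025RefinedTNC, status: under-review]
[cite: Kim2025RefinedTNC, Thm. 1.1 ("BSD"), App. §8.1.2 (ANNOUNCED preprint — the reason, not a source of truth)]
[cite: Kato2004Asterisque, Thm. 14.5 (3) (p. 236), Prop. 14.16 (2) (p. 244)]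
[cite: Wuthrich2014, Lemma 20 (p. 399)] [cite: Miller2011LMS, §1 and Def. 1.1] -/
theorem X4RankZero.bsdp_three_of_maninUnit_of_towerSurj_of_kuriharaIndexLeAt_of_cov
    (hK25s : Kim2025.thm11_kimShaLength_of_integralPeriod_OPEN)
    (hKatoS : Kato2004.rankZero_padicValNat_sha_le_sub_localTamagawa_of_additive_potGood_of_imageContainsSL2)
    (hDel : Delbourgo1998.prop4_rankZero_pow_dvd_constantCoeff)
    (hGZK : rank_eq_analyticRank_of_analyticRank_le_one) (hmod : hasEntireLFunction_rat)
    (hmodD : nonempty_modularParametrizationData)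
    (hKatoχ : Wuthrich2014.kato_halfEigenCharIdeal_dvd_cyclotomicPrime_of_surjective)
    {E₀ : WeierstrassCurve ℤ} (hI : integralModelInt W = E₀)
    (hΔ : (3 : ℤ) ∣ E₀.Δ) (hc₄ : (3 : ℤ) ∣ E₀.c₄)
    (htower : ∀ n : ℕ, W.HasSurjectiveModNGaloisRep (3 ^ n : ℕ)) (hr : W.analyticRank = 0)
    (hcov : padicValRat 3 W.j < 0 ∨
      padicValNat 3 W.tamagawaProduct =
        padicValNat 3 ((W.baseChange ℚ_[3]).localTamagawaNumber ℤ_[3]))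
    {N : ℕ} [NeZero N] (D : ModularParametrizationData W N)
    (hopt : ∀ z ∈ D.L.lattice, ∃ w ∈ periodLattice D.f, z = D.c * w)
    (hc3 : ¬ (3 : ℤ) ∣ D.maninConstant)
    (hK : haveI : Fact (Nat.Prime 3) := ⟨Nat.prime_three⟩;
      KuriharaIndexLeAt W 3 D.f (padicValNat 3 W.tamagawaProduct)) :
    haveI : Fact (Nat.Prime 3) := ⟨Nat.prime_three⟩
    BSDp W 3 := by
  haveI : Fact (Nat.Prime 3) := ⟨Nat.prime_three⟩
  have hsurj : W.HasSurjectiveModNGaloisRep 3 := by simpa using htower 1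
  have hX : ClassX4 W 3 :=
    ⟨by norm_num, addv_of_intModel hI 3 (by exact_mod_cast hΔ) (by exact_mod_cast hc₄),
      hasIrreducibleModPGaloisRep_of_hasSurjectiveModNGaloisRep W 3 hsurj⟩
  have hcov' : padicValRat 3 W.j < 0 ∨
      ((∀ n : ℕ, W.HasSurjectiveModNGaloisRep (3 ^ n : ℕ)) ∧
        padicValNat 3 W.tamagawaProduct =
          padicValNat 3 ((W.baseChange ℚ_[3]).localTamagawaNumber ℤ_[3]) ∧
        ∃ (N : ℕ) (_ : NeZero N) (D : ModularParametrizationData W N), ¬ (3 : ℤ) ∣ D.maninConstant) :=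
    hcov.imp_right fun ht => ⟨htower, ht, N, inferInstance, D, hc3⟩
  exact bsdp_of_missingPPartAt W 3 hGZK (by rw [hr]; exact zero_le_one)
    (missingPPartAt_of_lower_of_upper W 3
      (X4RankZero.missingLowerBoundAt_three_of_maninUnit_of_towerSurj_of_kuriharaIndexLeAt W hK25s hGZK
        hmod htower hr D hopt hc3 hK)
      (X4RankZero.missingUpperBoundAt_of_facts W 3 hKatoS hDel hGZK hmod hmodD
        Wuthrich2014.lemma20_surjective_threeAdic_of_semistable_holds hKatoχ hr hX hsurj hcov'))

end Summit.BirchSwinnertonDyer.Rank1Residual.Additive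

end
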